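import Literature.Geometry.Riemannian.ColdingMinicozziEntropy
import Literature.MeasureTheory.Hausdorff.SmoothImageBallGrowth
import HarnessLib

/-!
# Finiteness of the Colding–Minicozzi entropy: sets with area growth `≤ C ρⁿ`, closed immersed submanifolds

For the Gaussian area `F_{p,t}(A) = (4πt)^{-n/2} ∫_A e^{-|x-p|²/4t} d𝓗ⁿ` and the entropy
`λ(A) = sup_{p, t>0} F_{p,t}(A)` of `ColdingMinicozziEntropy.lean` (`gaussianArea`,
`gaussianEntropy`, with `𝓗ⁿ = μHE[n]`), we prove:

* `gaussianArea_le_of_ball_growth`, `gaussianEntropy_le_of_ball_growth`,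
  `gaussianEntropy_lt_top_of_ball_growth` — **area growth `𝓗ⁿ(A ∩ B_ρ(p)) ≤ C ρⁿ` for all
  balls bounds every Gaussian area by `C · π^{-n/2} · Jₙ`**, `Jₙ = ∫₀¹ (log(1/s))^{n/2} ds`
  (`= Γ(n/2 + 1)`), uniformly in the centre and the scale, hence `λ(A) ≤ C π^{-n/2} Jₙ < ∞`
  when `C < ∞`. Proof: layer-cake formula for `∫_A e^{-|x-p|²/4t} d𝓗ⁿ`
  (`MeasureTheory.lintegral_eq_lintegral_meas_lt`), the super-level sets of the Gaussian
  weight being the balls `B(p, √(4t log(1/s)))`, `0 < s < 1` (`setOf_lt_gaussian_eq_ball`), so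
  that `∫_A e^{-|x-p|²/4t} ≤ C (4t)^{n/2} Jₙ` and the factor `t^{n/2}` cancels against the
  normalisation `(4πt)^{-n/2}`; `Jₙ < ∞` by the elementary bound
  `u^a ≤ 1 + 2^m m! e^{u/2}` (`m = ⌈a⌉`), i.e. `(log(1/s))^{n/2} ≤ 1 + c s^{-1/2}` on `(0,1)`
  (`lintegral_negLog_rpow_lt_top`).
* `gaussianEntropy_range_lt_top` — **the entropy of a closed immersed submanifold is finite**:
  for a compact manifold `M` modelled (boundaryless) on an `n`-dimensional real normed space and
  a `C¹` map `f : M → F` into a finite-dimensional inner product space with injective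
  differential everywhere, `gaussianEntropy n (range f) < ∞` — by the area-growth bound of the
  tree's `Literature.MeasureTheory.Hausdorff.exists_hausdorffMeasure_range_inter_ball_le`
  (`SmoothImageBallGrowth.lean`). This is the standing finiteness `λ(Σ) < ∞` of the entropy of
  a closed hypersurface in the mean-curvature-flow literature (Colding–Minicozzi 2012, Lemma 7.2
  and §7; Chodosh–Mantoulidis–Schulze, Def. 1.6/1.8).

Everything is proved; no definitions and no named facts are introduced.

## References

* T. H. Colding, W. P. Minicozzi II, *Generic mean curvature flow I; generic singularities*,
  Ann. of Math. 175 (2012) 755–833, §7, Lemma 7.2. [ColdingMinicozzi2012]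
* H. Federer, *Geometric Measure Theory* (1969), 2.10.11. [Federer1969]
-/

noncomputable section

open Set Function Filter Module Metric
open _root_.MeasureTheory _root_.MeasureTheory.Measure
open scoped ENNReal NNReal Topology Manifold

namespace Literature.Geometry.Riemannian

/-! ### The constant `Jₐ = ∫₀¹ (log(1/s))^a ds` is finite -/

section Constant

/-- Elementary bound: `u^a ≤ 1 + 2^m · m! · e^{u/2}` for `u ≥ 0`, `a ≥ 0`, `m = ⌈a⌉₊`
(`u^a ≤ 1 + u^m`, and `(u/2)^m / m! ≤ e^{u/2}`, Mathlib's `Real.pow_div_factorial_le_exp`).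
[folklore] -/
theorem rpow_le_one_add_mul_exp_half {u a : ℝ} (hu : 0 ≤ u) (ha : 0 ≤ a) :
    u ^ a ≤ 1 + 2 ^ (⌈a⌉₊) * (⌈a⌉₊).factorial * Real.exp (u / 2) := by
  set m := ⌈a⌉₊ with hm
  have ham : a ≤ m := Nat.le_ceil a
  have h1 : u ^ a ≤ 1 + u ^ m := by
    rcases le_or_gt u 1 with hu1 | hu1
    · have : u ^ a ≤ 1 := Real.rpow_le_one hu hu1 ha
      have : 0 ≤ u ^ m := pow_nonneg hu m
      linarith
    · have : u ^ a ≤ u ^ (m : ℝ) := Real.rpow_le_rpow_of_exponent_le hu1.le ham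
      rw [Real.rpow_natCast] at this
      linarith
  have h2 : u ^ m ≤ 2 ^ m * m.factorial * Real.exp (u / 2) := by
    have h := Real.pow_div_factorial_le_exp (x := u / 2) (by positivity) m
    rw [div_pow, div_div, div_le_iff₀ (by positivity)] at h
    calc u ^ m ≤ Real.exp (u / 2) * (2 ^ m * m.factorial) := h
      _ = 2 ^ m * m.factorial * Real.exp (u / 2) := by ring
  linarith

/-- `e^{-log s / 2} = s^{-1/2}` for `s > 0`. [folklore] -/
theorem exp_neg_log_half {s : ℝ} (hs : 0 < s) :
    Real.exp (-Real.log s / 2) = s ^ (-(1 / 2 : ℝ)) := by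
  rw [Real.rpow_def_of_pos hs]
  congr 1
  ring

/-- **`∫₀¹ (log(1/s))^a ds < ∞`** for every `a ≥ 0` (it equals `Γ(a + 1)`; only finiteness is
proved, from `(log(1/s))^a ≤ 1 + c · s^{-1/2}` on `(0, 1)` and the integrability of `s^{-1/2}`
there, Mathlib's `intervalIntegral.integrableOn_Ioo_rpow_iff`). [folklore] -/
theorem lintegral_negLog_rpow_lt_top {a : ℝ} (ha : 0 ≤ a) :
    ∫⁻ s in Ioo (0 : ℝ) 1, ENNReal.ofReal ((-Real.log s) ^ a) < ∞ := by
  set m := ⌈a⌉₊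
  set c : ℝ := 2 ^ m * m.factorial with hc
  have hbound : ∀ s ∈ Ioo (0 : ℝ) 1,
      ENNReal.ofReal ((-Real.log s) ^ a) ≤ ENNReal.ofReal (1 + c * s ^ (-(1 / 2 : ℝ))) := by
    intro s hs
    apply ENNReal.ofReal_le_ofReal
    have hu : 0 ≤ -Real.log s := by
      rw [neg_nonneg]
      exact Real.log_nonpos hs.1.le hs.2.le
    have h := rpow_le_one_add_mul_exp_half hu ha
    rw [exp_neg_log_half hs.1] at h
    simpa [hc, mul_assoc] using h
  have hint : IntegrableOn (fun s : ℝ => 1 + c * s ^ (-(1 / 2 : ℝ))) (Ioo (0 : ℝ) 1) := by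
    refine (integrableOn_const ?_).add ?_
    · simp
    · exact ((intervalIntegral.integrableOn_Ioo_rpow_iff one_pos).2 (by norm_num)).const_mul c
  calc ∫⁻ s in Ioo (0 : ℝ) 1, ENNReal.ofReal ((-Real.log s) ^ a)
      ≤ ∫⁻ s in Ioo (0 : ℝ) 1, ENNReal.ofReal (1 + c * s ^ (-(1 / 2 : ℝ))) :=
        setLIntegral_mono' measurableSet_Ioo hbound
    _ ≤ ∫⁻ s in Ioo (0 : ℝ) 1, ‖(1 + c * s ^ (-(1 / 2 : ℝ)))‖ₑ :=
        lintegral_mono fun s => Real.ofReal_le_enorm _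
    _ < ∞ := hint.2

end Constant

/-! ### Super-level sets of the Gaussian weight -/

section LevelSets

variable {E : Type*} [NormedAddCommGroup E]

/-- For `t > 0` and `0 < s`, the super-level set `{x | s < e^{-‖x-p‖²/4t}}` of the Gaussian
weight is the open ball `B(p, √(4t · log(1/s)))` (empty radius when `s ≥ 1`). [folklore] -/
theorem setOf_lt_gaussian_eq_ball (p : E) {t : ℝ} (ht : 0 < t) {s : ℝ} (hs : 0 < s) :
    {x : E | s < Real.exp (-(‖x - p‖ ^ 2) / (4 * t))} =
      ball p (Real.sqrt (4 * t * -Real.log s)) := by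
  ext x
  rw [mem_setOf_eq, mem_ball, dist_eq_norm, ← Real.log_lt_iff_lt_exp hs,
    Real.lt_sqrt (norm_nonneg _), lt_div_iff₀ (by positivity : (0 : ℝ) < 4 * t)]
  constructor <;> intro h <;> nlinarith

/-- For `t ≥ 0` and `s ≥ 1` the super-level set `{x | s < e^{-‖x-p‖²/4t}}` is empty (the
weight is at most `1`). [folklore] -/
theorem setOf_lt_gaussian_eq_empty (p : E) (t : ℝ) (ht : 0 ≤ t) {s : ℝ} (hs1 : 1 ≤ s) :
    {x : E | s < Real.exp (-(‖x - p‖ ^ 2) / (4 * t))} = ∅ := by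
  ext x
  simp only [mem_setOf_eq, mem_empty_iff_false, iff_false, not_lt]
  refine (Real.exp_le_one_iff.2 ?_).trans hs1
  exact div_nonpos_of_nonpos_of_nonneg (neg_nonpos.2 (sq_nonneg _)) (by positivity)

end LevelSets

/-! ### Area growth on balls bounds the Gaussian areas uniformly -/

section Growth

variable {E : Type*} [NormedAddCommGroup E] [MeasurableSpace E] [BorelSpace E]

/-- **Layer-cake estimate.** If `𝓗ⁿ(A ∩ B_ρ(p)) ≤ C ρⁿ` for all centres and radii
(`𝓗ⁿ = μHE[n]`), then for `t > 0`
`∫_A e^{-|x-p|²/4t} d𝓗ⁿ ≤ C · (4t)^{n/2} · ∫₀¹ (log(1/s))^{n/2} ds`: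
`∫_A w = ∫₀^∞ 𝓗ⁿ(A ∩ {w > s}) ds` (Mathlib's `lintegral_eq_lintegral_meas_lt`), `{w > s}` is
empty for `s ≥ 1` and the ball `B(p, √(4t log(1/s)))` for `0 < s < 1`, of radius to the `n`-th
power `(4t)^{n/2} (log(1/s))^{n/2}`. (Colding–Minicozzi 2012, proof of Lemma 7.2, where the
polynomial area growth of `Σ` is used in the same way.) [cite: ColdingMinicozzi2012, Lemma 7.2] -/
theorem lintegral_gaussianWeight_le_of_ball_growth {n : ℕ} {A : Set E} {C : ℝ≥0∞}
    (hA : ∀ (p : E) (ρ : ℝ), (μHE[n] : Measure E) (A ∩ ball p ρ) ≤ C * ENNReal.ofReal (ρ ^ n))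
    (p : E) {t : ℝ} (ht : 0 < t) :
    ∫⁻ x in A, gaussianWeight p t x ∂(μHE[n] : Measure E) ≤
      C * ENNReal.ofReal ((4 * t) ^ ((n : ℝ) / 2)) *
        ∫⁻ s in Ioo (0 : ℝ) 1, ENNReal.ofReal ((-Real.log s) ^ ((n : ℝ) / 2)) := by
  set μ : Measure E := (μHE[n] : Measure E).restrict A with hμ
  set J : ℝ≥0∞ := ∫⁻ s in Ioo (0 : ℝ) 1, ENNReal.ofReal ((-Real.log s) ^ ((n : ℝ) / 2)) with hJ
  have hmeas : AEMeasurable (fun x : E => Real.exp (-(‖x - p‖ ^ 2) / (4 * t))) μ := by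
    fun_prop
  have hlayer := lintegral_eq_lintegral_meas_lt μ
    (f := fun x : E => Real.exp (-(‖x - p‖ ^ 2) / (4 * t)))
    (Eventually.of_forall fun x => (Real.exp_pos _).le) hmeas
  have hlhs : ∫⁻ x in A, gaussianWeight p t x ∂(μHE[n] : Measure E) =
      ∫⁻ x, ENNReal.ofReal (Real.exp (-(‖x - p‖ ^ 2) / (4 * t))) ∂μ := rfl
  rw [hlhs, hlayer]
  -- split `(0, ∞) = (0, 1) ∪ [1, ∞)`
  have hsplit : Ioi (0 : ℝ) = Ioo 0 1 ∪ Ici 1 := (Ioo_union_Ici_eq_Ioi zero_lt_one).symm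
  have hdisj : Disjoint (Ioo (0 : ℝ) 1) (Ici 1) :=
    disjoint_left.2 fun s hs hs' => not_le.2 hs.2 hs'
  rw [hsplit, lintegral_union measurableSet_Ici hdisj]
  -- the part `s ≥ 1` vanishes
  have hzero : ∫⁻ s in Ici (1 : ℝ), μ {x : E | s < Real.exp (-(‖x - p‖ ^ 2) / (4 * t))} = 0 := by
    rw [setLIntegral_congr_fun measurableSet_Ici
      (fun s hs => by rw [setOf_lt_gaussian_eq_empty p t ht.le (mem_Ici.1 hs), measure_empty])]
    exact lintegral_zero
  rw [hzero, add_zero]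
  -- the part `0 < s < 1`: balls of radius `√(4t log(1/s))`
  have hball : ∀ s ∈ Ioo (0 : ℝ) 1,
      μ {x : E | s < Real.exp (-(‖x - p‖ ^ 2) / (4 * t))} ≤
        C * ENNReal.ofReal ((4 * t) ^ ((n : ℝ) / 2)) *
          ENNReal.ofReal ((-Real.log s) ^ ((n : ℝ) / 2)) := by
    intro s hs
    have hlog : 0 ≤ -Real.log s := neg_nonneg.2 (Real.log_nonpos hs.1.le hs.2.le)
    rw [setOf_lt_gaussian_eq_ball p ht hs.1, hμ, Measure.restrict_apply measurableSet_ball,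
      inter_comm]
    refine (hA p _).trans (le_of_eq ?_)
    have hR : Real.sqrt (4 * t * -Real.log s) ^ n =
        (4 * t) ^ ((n : ℝ) / 2) * (-Real.log s) ^ ((n : ℝ) / 2) := by
      rw [Real.sqrt_eq_rpow, ← Real.rpow_natCast,
        ← Real.rpow_mul (mul_nonneg (by positivity) hlog), ← Real.mul_rpow (by positivity) hlog]
      congr 1
      ring
    rw [hR, ENNReal.ofReal_mul (Real.rpow_nonneg (by positivity) _), mul_assoc]
  calc ∫⁻ s in Ioo (0 : ℝ) 1, μ {x : E | s < Real.exp (-(‖x - p‖ ^ 2) / (4 * t))}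
      ≤ ∫⁻ s in Ioo (0 : ℝ) 1, C * ENNReal.ofReal ((4 * t) ^ ((n : ℝ) / 2)) *
          ENNReal.ofReal ((-Real.log s) ^ ((n : ℝ) / 2)) := setLIntegral_mono' measurableSet_Ioo hball
    _ = C * ENNReal.ofReal ((4 * t) ^ ((n : ℝ) / 2)) * J := by
        have hmJ : Measurable fun s : ℝ => ENNReal.ofReal ((-Real.log s) ^ ((n : ℝ) / 2)) := by
          fun_prop
        rw [hJ, ← lintegral_const_mul _ hmJ]

/-- **Area growth bounds every Gaussian area, uniformly in centre and scale**:
if `𝓗ⁿ(A ∩ B_ρ(p)) ≤ C ρⁿ` for all `p, ρ`, then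
`F_{p,t}(A) ≤ C · π^{-n/2} · ∫₀¹ (log(1/s))^{n/2} ds` for every `p` and `t > 0` (the scale
`t^{n/2}` of the layer-cake bound cancels against the normalisation `(4πt)^{-n/2}`).
[cite: ColdingMinicozzi2012, Lemma 7.2] -/
theorem gaussianArea_le_of_ball_growth {n : ℕ} {A : Set E} {C : ℝ≥0∞}
    (hA : ∀ (p : E) (ρ : ℝ), (μHE[n] : Measure E) (A ∩ ball p ρ) ≤ C * ENNReal.ofReal (ρ ^ n))
    (p : E) {t : ℝ} (ht : 0 < t) :
    gaussianArea n p t A ≤ C * ENNReal.ofReal (Real.pi ^ (-(n : ℝ) / 2)) *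
      ∫⁻ s in Ioo (0 : ℝ) 1, ENNReal.ofReal ((-Real.log s) ^ ((n : ℝ) / 2)) := by
  set J : ℝ≥0∞ := ∫⁻ s in Ioo (0 : ℝ) 1, ENNReal.ofReal ((-Real.log s) ^ ((n : ℝ) / 2)) with hJ
  rw [gaussianArea_eq]
  refine (mul_le_mul' le_rfl (lintegral_gaussianWeight_le_of_ball_growth hA p ht)).trans
    (le_of_eq ?_)
  rw [gaussianNormalization]
  have hkey : (4 * Real.pi * t) ^ (-(n : ℝ) / 2) * (4 * t) ^ ((n : ℝ) / 2) =
      Real.pi ^ (-(n : ℝ) / 2) := by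
    rw [show 4 * Real.pi * t = Real.pi * (4 * t) by ring,
      Real.mul_rpow (by positivity) (by positivity), mul_assoc,
      ← Real.rpow_add (by positivity : (0 : ℝ) < 4 * t),
      show (-(n : ℝ) / 2 + (n : ℝ) / 2) = 0 by ring, Real.rpow_zero, mul_one]
  calc ENNReal.ofReal ((4 * Real.pi * t) ^ (-(n : ℝ) / 2)) *
        (C * ENNReal.ofReal ((4 * t) ^ ((n : ℝ) / 2)) * J)
      = C * (ENNReal.ofReal ((4 * Real.pi * t) ^ (-(n : ℝ) / 2)) *
          ENNReal.ofReal ((4 * t) ^ ((n : ℝ) / 2))) * J := by ring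
    _ = C * ENNReal.ofReal (Real.pi ^ (-(n : ℝ) / 2)) * J := by
        rw [← ENNReal.ofReal_mul (Real.rpow_nonneg (by positivity) _), hkey]

/-- **Area growth bounds the entropy**: `𝓗ⁿ(A ∩ B_ρ(p)) ≤ C ρⁿ` for all balls implies
`λ(A) ≤ C · π^{-n/2} · ∫₀¹ (log(1/s))^{n/2} ds`. [cite: ColdingMinicozzi2012, Lemma 7.2] -/
theorem gaussianEntropy_le_of_ball_growth {n : ℕ} {A : Set E} {C : ℝ≥0∞}
    (hA : ∀ (p : E) (ρ : ℝ), (μHE[n] : Measure E) (A ∩ ball p ρ) ≤ C * ENNReal.ofReal (ρ ^ n)) :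
    gaussianEntropy n A ≤ C * ENNReal.ofReal (Real.pi ^ (-(n : ℝ) / 2)) *
      ∫⁻ s in Ioo (0 : ℝ) 1, ENNReal.ofReal ((-Real.log s) ^ ((n : ℝ) / 2)) := by
  rw [gaussianEntropy_eq_iSup]
  exact iSup_le fun p => iSup_le fun t => iSup_le fun ht => gaussianArea_le_of_ball_growth hA p ht

/-- **Sets with area growth `≤ C ρⁿ`, `C < ∞`, have finite entropy.**
[cite: ColdingMinicozzi2012, Lemma 7.2] -/
theorem gaussianEntropy_lt_top_of_ball_growth {n : ℕ} {A : Set E} {C : ℝ≥0∞}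
    (hA : ∀ (p : E) (ρ : ℝ), (μHE[n] : Measure E) (A ∩ ball p ρ) ≤ C * ENNReal.ofReal (ρ ^ n))
    (hC : C < ∞) : gaussianEntropy n A < ∞ :=
  (gaussianEntropy_le_of_ball_growth hA).trans_lt
    (ENNReal.mul_lt_top (ENNReal.mul_lt_top hC ENNReal.ofReal_lt_top)
      (lintegral_negLog_rpow_lt_top (by positivity)))

end Growth

/-! ### Closed immersed submanifolds have finite entropy -/

section Manifold

variable {EM : Type*} [NormedAddCommGroup EM] [NormedSpace ℝ EM] [FiniteDimensional ℝ EM]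
  {H : Type*} [TopologicalSpace H] {I : ModelWithCorners ℝ EM H} [I.Boundaryless]
  {M : Type*} [TopologicalSpace M] [ChartedSpace H M] [CompactSpace M]
  {F : Type*} [NormedAddCommGroup F] [InnerProductSpace ℝ F] [MeasurableSpace F] [BorelSpace F]

/-- **The entropy of a closed immersed submanifold is finite.** Let `M` be a compact manifold
modelled by a boundaryless model with corners on a real normed space `EM` of dimension `n`, and
`f : M → F` a map into an inner product space which is `C¹` with injective differential at
every point (e.g. a `C^∞` embedding of a closed `n`-manifold as a hypersurface of `ℝⁿ⁺¹`).
Then `λ(f(M)) = gaussianEntropy n (range f) < ∞`: the image has area growth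
`𝓗ⁿ(f(M) ∩ B_ρ(p)) ≤ C ρⁿ` (`Literature.MeasureTheory.Hausdorff.exists_hausdorffMeasure_range_inter_ball_le`,
transferred to `μHE[n] = c · μH[n]`), and `gaussianEntropy_lt_top_of_ball_growth` applies. This
is the finiteness `λ(Σ) < ∞` of the entropy of a closed hypersurface (Colding–Minicozzi 2012,
Lemma 7.2, §7). [cite: ColdingMinicozzi2012, Lemma 7.2] -/
theorem gaussianEntropy_range_lt_top {n : ℕ} (hn : finrank ℝ EM = n) {f : M → F}
    (hf : ∀ x, ContMDiffAt I 𝓘(ℝ, F) 1 f x) (hd : ∀ x, Injective (mfderiv I 𝓘(ℝ, F) f x)) :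
    gaussianEntropy n (range f) < ∞ := by
  subst hn
  obtain ⟨C, hC, hbound⟩ :=
    MeasureTheory.Hausdorff.exists_hausdorffMeasure_range_inter_ball_le hf hd
  set c : ℝ≥0 := addHaarScalarFactor (volume : Measure (EuclideanSpace ℝ (Fin (finrank ℝ EM))))
    (μH[finrank ℝ EM] : Measure (EuclideanSpace ℝ (Fin (finrank ℝ EM)))) with hc
  have key : ∀ (p : F) (ρ : ℝ), (μHE[finrank ℝ EM] : Measure F) (range f ∩ ball p ρ) ≤
      ((c : ℝ≥0∞) * C) * ENNReal.ofReal (ρ ^ finrank ℝ EM) := by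
    intro p ρ
    rw [euclideanHausdorffMeasure_def, Measure.smul_apply, ENNReal.smul_def, smul_eq_mul,
      mul_assoc]
    exact mul_le_mul' le_rfl (hbound p ρ)
  exact gaussianEntropy_lt_top_of_ball_growth key (ENNReal.mul_lt_top ENNReal.coe_lt_top hC)

/-- The same for a globally `C^m` (`m ≥ 1`) map with injective differential, e.g. the `C^∞`
embedding of a closed hypersurface. [cite: ColdingMinicozzi2012, Lemma 7.2] -/
theorem gaussianEntropy_range_lt_top_of_contMDiff {n : ℕ} (hn : finrank ℝ EM = n) {f : M → F}
    {m : WithTop ℕ∞} (hf : ContMDiff I 𝓘(ℝ, F) m f) (hm : 1 ≤ m)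
    (hd : ∀ x, Injective (mfderiv I 𝓘(ℝ, F) f x)) :
    gaussianEntropy n (range f) < ∞ :=
  gaussianEntropy_range_lt_top hn (fun _ => (hf.of_le hm).contMDiffAt) hd

end Manifold

end Literature.Geometry.Riemannian

end
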